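import Summits.CriticalPhenomena.Ising3D.TaylorCertificateConeObligations
import Summits.CriticalPhenomena.Ising3D.TaylorOddConeKernel
import Mathlib.Tactic.Linarith
import Mathlib.Tactic.Positivity
import Mathlib.Tactic.Ring
import HarnessLib

/-!
# Odd head cells: introducing `TaylorConeObligations.odd_cell` from a finite cell cover
(cell `pub-ising3x`, seat recog-1 gen 10; bookkeeping between the cone obligations (D)/(D5b) of
`TaylorCertificateConeObligations` and a rational TABLE: the `∀ Δ ∈ (bound_ℓ, E_T)` quantifier of `odd_cell`
becomes finitely many cells with their CANONICAL head sets, OBLIGATIONS-pmp1-deriv rc0 §1 (D-head); no data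
format is fixed here — cells are real intervals and the per-cell hypotheses stay uniform in `Δ ∈ cell`)

HONEST FRAMING: lottery ticket; floor = tightest certified 3D Ising CFT bounds; no exact-solution
claim without a proof.

* `OddHeadCell` = `(ℓ, a, b, F)`: spin, closed `Δ`-interval `[a, b]`, head set `F`.
* `oddCellField_of_cover`: if every admissible odd `(Δ, ℓ)` below `E_T` (A4 gap clause for `ℓ = 0`) lies in
  some listed cell of its spin, each cell's head inequality `0 ≤ Σ_{q∈F} oddConeHeadValue` holds uniformly on the
  cell (the A4 gap clause `ℓ = 0 → Δ < 3 → Δ = Δσ` is handed to the cell, so the `σ`-row cell is checked AT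
  `Δ = Δσ`, correlated with the box), every descendant term OFF `F` has `a + n ≥ E_T` (so it lies in the cone), and the cone field holds, then
  the `odd_cell` field of `TaylorConeObligations` holds; `TaylorConeObligations.of_oddCover` assembles the
  structure.
* `exists_mem_gridCell`: a grid `e 0 ≤ e 1 ≤ … ≤ e (n+1)` (monotonicity not even needed) covers `[e 0, e (n+1)]`
  by the cells `[e k, e (k+1)]`; `oddCover_of_perSpin`: the cover hypothesis from per-spin covers (`σ` row,
  `[3, E_T)` for `ℓ = 0`, `(ℓ+1, E_T)` for `1 ≤ ℓ < L`, nothing for `ℓ ≥ L` when `E_T ≤ L + 1`).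
* `oddConeField_half_of_kernelCone`: the `odd_cone` field over a set `Q` from the pointwise kernel
  inequalities (KM)/(KR) of `TaylorOddConeKernel` at every `(Δσ, Δε) ∈ Q`; `oddConeField_half_of_hybrid`:
  small `j ≤ J₁` by the exact q-form (one real variable `E` per integer `j`), `j > J₁` by the kernel
  inequalities on the far region `u + v ≥ E₁` (`E₁ ≤ J₁ + 1`) only.
Elementary. Sources: Kos–Poland–Simmons-Duffin 2014 §3.3 eq. (3.16) (as typed upstream).
-/

namespace Summit.CriticalPhenomena.Ising3D

open Finset Set
open Literature.MathematicalPhysics.QuantumFieldTheory.ConformalBootstrap3D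

/-- An odd head-cell datum: spin `ℓ`, closed `Δ`-interval `[a, b]`, head set `F`. [folklore] -/
structure OddHeadCell where
  /-- the spin of the cell -/
  ℓ : ℕ
  /-- left end of the `Δ`-interval -/
  a : ℝ
  /-- right end of the `Δ`-interval -/
  b : ℝ
  /-- the head set used on the cell -/
  F : Finset (ℕ × ℕ)

/-- **`odd_cell` from a finite cell cover** (module docstring). [cite: KosPolandSimmonsduffin2014, §3.3 eq. (3.16)] -/
theorem oddCellField_of_cover (α : CrossingFunctional) (Ψ : (ℝ → ℝ → ℝ) →ₗ[ℝ] ℝ) (κ₀ : ℝ)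
    (Q : Set (ℝ × ℝ)) (E_T : ℝ) (cells : List OddHeadCell)
    (hcover : ∀ p ∈ Q, ∀ (ℓ : ℕ) (Δ : ℝ), unitarityBound3D ℓ < Δ → Δ < E_T →
      (ℓ = 0 → Δ < 3 → Δ = p.1) → ∃ c ∈ cells, c.ℓ = ℓ ∧ c.a ≤ Δ ∧ Δ ≤ c.b)
    (hhead : ∀ c ∈ cells, ∀ p ∈ Q, ∀ Δ : ℝ, c.a ≤ Δ → Δ ≤ c.b → unitarityBound3D c.ℓ < Δ → Δ < E_T →
      (c.ℓ = 0 → Δ < 3 → Δ = p.1) → 0 ≤ ∑ q ∈ c.F, oddConeHeadValue α Ψ κ₀ p.1 p.2 Δ c.ℓ q)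
    (hF : ∀ c ∈ cells, ∀ q : ℕ × ℕ, q ∉ c.F → InDescendantRange c.ℓ q.1 q.2 → E_T ≤ c.a + (q.1 : ℝ))
    (hcone : ∀ p ∈ Q, ∀ (E : ℝ) (j : ℕ), E_T ≤ E → (j : ℝ) ≤ E → OddConeAt α Ψ κ₀ p.1 p.2 E j) :
    ∀ p ∈ Q, ∀ (ℓ : ℕ) (Δ : ℝ), unitarityBound3D ℓ < Δ → Δ < E_T → (ℓ = 0 → Δ < 3 → Δ = p.1) →
      ∃ F : Finset (ℕ × ℕ), 0 ≤ ∑ q ∈ F, oddConeHeadValue α Ψ κ₀ p.1 p.2 Δ ℓ q ∧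
        ∀ q : ℕ × ℕ, q ∉ F → InDescendantRange ℓ q.1 q.2 →
          OddConeAt α Ψ κ₀ p.1 p.2 (Δ + (q.1 : ℝ)) q.2 := by
  intro p hp ℓ Δ hlt hE hgap
  obtain ⟨c, hc, hcℓ, ha, hb⟩ := hcover p hp ℓ Δ hlt hE hgap
  subst hcℓ
  refine ⟨c.F, hhead c hc p hp Δ ha hb hlt hE hgap, fun q hq hr => ?_⟩
  have hℓΔ : (c.ℓ : ℝ) ≤ Δ := (natCast_le_unitarityBound3D c.ℓ).trans hlt.le
  have hE' : E_T ≤ Δ + (q.1 : ℝ) := (hF c hc q hq hr).trans (by linarith)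
  exact hcone p hp (Δ + (q.1 : ℝ)) q.2 hE' (cast_le_add_of_inDescendantRange hℓΔ hr)

/-- **The cone obligations from a cell cover**: assemble `TaylorConeObligations` from the identity and even
fields, an odd cell cover, and the cone field. [cite: KosPolandSimmonsduffin2014, §3.3 eq. (3.16)] -/
theorem TaylorConeObligations.of_oddCover {α : CrossingFunctional} {Ψ : (ℝ → ℝ → ℝ) →ₗ[ℝ] ℝ} {κ₀ : ℝ}
    {Q : Set (ℝ × ℝ)} {E₀ E_T : ℝ}
    (hI : ∀ p ∈ Q, 0 < α.identityTerm p.1 p.2)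
    (hEc : ∀ p ∈ Q, ∀ (ℓ : ℕ) (Δ : ℝ), Even ℓ → IsAdmissible3D Δ ℓ → Δ < E₀ →
      (ℓ = 0 → Δ < 3 → Δ = p.2) →
      ∃ F : Finset (ℕ × ℕ),
        (∀ a b : ℝ, 0 ≤ ∑ q ∈ F, hrCoeff Δ ℓ q.1 q.2 / legendreLam ℓ *
          α.evenForm p.1 p.2 (zMono (Δ + (q.1 : ℝ)) q.2) a b) ∧
        (∀ q : ℕ × ℕ, q ∉ F → InDescendantRange ℓ q.1 q.2 →
          ∀ a b : ℝ, 0 ≤ α.evenForm p.1 p.2 (zMono (Δ + (q.1 : ℝ)) q.2) a b))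
    (hEr : TaylorEvenRegion α Q E₀) (cells : List OddHeadCell)
    (hcover : ∀ p ∈ Q, ∀ (ℓ : ℕ) (Δ : ℝ), unitarityBound3D ℓ < Δ → Δ < E_T →
      (ℓ = 0 → Δ < 3 → Δ = p.1) → ∃ c ∈ cells, c.ℓ = ℓ ∧ c.a ≤ Δ ∧ Δ ≤ c.b)
    (hhead : ∀ c ∈ cells, ∀ p ∈ Q, ∀ Δ : ℝ, c.a ≤ Δ → Δ ≤ c.b → unitarityBound3D c.ℓ < Δ → Δ < E_T →
      (c.ℓ = 0 → Δ < 3 → Δ = p.1) → 0 ≤ ∑ q ∈ c.F, oddConeHeadValue α Ψ κ₀ p.1 p.2 Δ c.ℓ q)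
    (hF : ∀ c ∈ cells, ∀ q : ℕ × ℕ, q ∉ c.F → InDescendantRange c.ℓ q.1 q.2 → E_T ≤ c.a + (q.1 : ℝ))
    (hcone : ∀ p ∈ Q, ∀ (E : ℝ) (j : ℕ), E_T ≤ E → (j : ℝ) ≤ E → OddConeAt α Ψ κ₀ p.1 p.2 E j) :
    TaylorConeObligations α Ψ κ₀ Q E₀ E_T :=
  ⟨hI, hEc, hEr, oddCellField_of_cover α Ψ κ₀ Q E_T cells hcover hhead hF hcone, hcone⟩

/-- **A grid covers its span by consecutive cells**: for `e : ℕ → ℝ` and `Δ ∈ [e 0, e (n+1)]` there is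
`k ≤ n` with `Δ ∈ [e k, e (k+1)]` (no monotonicity needed). [folklore] -/
theorem exists_mem_gridCell (e : ℕ → ℝ) (n : ℕ) {Δ : ℝ} (h0 : e 0 ≤ Δ) (h1 : Δ ≤ e (n + 1)) :
    ∃ k, k ≤ n ∧ e k ≤ Δ ∧ Δ ≤ e (k + 1) := by
  induction n with
  | zero => exact ⟨0, le_rfl, h0, h1⟩
  | succ n ih =>
    rcases le_or_gt Δ (e (n + 1)) with hle | hgt
    · obtain ⟨k, hk, hk0, hk1⟩ := ih hle
      exact ⟨k, Nat.le_succ_of_le hk, hk0, hk1⟩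
    · exact ⟨n + 1, le_rfl, hgt.le, h1⟩

/-- **The cover hypothesis spin by spin.** With `E_T ≤ L + 1` only spins `ℓ < L` need cells: `ℓ = 0` needs
cells containing every `Δσ` of the box (the `σ` row; A4 gap) and cells covering `[3, E_T)`; `1 ≤ ℓ < L` needs
cells covering `(ℓ+1, E_T)`; higher spins have their unitarity bound `≥ E_T`. [folklore] -/
theorem oddCover_of_perSpin (Q : Set (ℝ × ℝ)) (E_T : ℝ) (cells : List OddHeadCell) (L : ℕ)
    (hL : E_T ≤ (L : ℝ) + 1)
    (hσ : ∀ p ∈ Q, ∃ c ∈ cells, c.ℓ = 0 ∧ c.a ≤ p.1 ∧ p.1 ≤ c.b)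
    (h0 : ∀ Δ : ℝ, 3 ≤ Δ → Δ < E_T → ∃ c ∈ cells, c.ℓ = 0 ∧ c.a ≤ Δ ∧ Δ ≤ c.b)
    (hℓ : ∀ ℓ : ℕ, 1 ≤ ℓ → ℓ < L → ∀ Δ : ℝ, (ℓ : ℝ) + 1 < Δ → Δ < E_T →
      ∃ c ∈ cells, c.ℓ = ℓ ∧ c.a ≤ Δ ∧ Δ ≤ c.b) :
    ∀ p ∈ Q, ∀ (ℓ : ℕ) (Δ : ℝ), unitarityBound3D ℓ < Δ → Δ < E_T →
      (ℓ = 0 → Δ < 3 → Δ = p.1) → ∃ c ∈ cells, c.ℓ = ℓ ∧ c.a ≤ Δ ∧ Δ ≤ c.b := by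
  intro p hp ℓ Δ hb hE hgap
  rcases Nat.eq_zero_or_pos ℓ with hℓ0 | hℓpos
  · subst hℓ0
    rcases lt_or_ge Δ 3 with h3 | h3
    · rw [hgap rfl h3]; exact hσ p hp
    · exact h0 Δ h3 hE
  · have hbℓ : unitarityBound3D ℓ = (ℓ : ℝ) + 1 := by
      unfold unitarityBound3D; rw [if_neg (by omega)]
    rw [hbℓ] at hb
    by_cases hlt : ℓ < L
    · exact hℓ ℓ hℓpos hlt Δ hb hE
    · exfalso
      have : (L : ℝ) ≤ ℓ := by exact_mod_cast not_lt.mp hlt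
      linarith

/-- The canonical head set condition `hF` in closed form: if `F ⊇ {(n,j) in the descendant range : a + n < E_T}`
— stated as: every descendant `(n,j)` with `(n : ℝ) < E_T - a` lies in `F` — then off `F` one has `E_T ≤ a + n`.
[folklore] -/
theorem headSet_offCone {ℓ : ℕ} {a E_T : ℝ} {F : Finset (ℕ × ℕ)}
    (hF : ∀ q : ℕ × ℕ, InDescendantRange ℓ q.1 q.2 → (q.1 : ℝ) < E_T - a → q ∈ F) :
    ∀ q : ℕ × ℕ, q ∉ F → InDescendantRange ℓ q.1 q.2 → E_T ≤ a + (q.1 : ℝ) := by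
  intro q hq hr
  by_contra h
  exact hq (hF q hr (by linarith [not_le.mp h]))

/-- **The `odd_cone` field over a set `Q` from the pointwise kernel inequalities** (KM)/(KR) of
`TaylorOddConeKernel` at every `(Δσ, Δε) ∈ Q` (`α = taylorCrossing ½ ½ S w`, `Ψ = Σ ψ • taylorCoeffAt ½ ½`,
`κ₀ ≥ 0`). [cite: KosPolandSimmonsduffin2014, §3.3 eq. (3.16)] -/
theorem oddConeField_half_of_kernelCone (S : Finset (ℕ × ℕ)) (w : Fin 5 → ℕ × ℕ → ℝ)
    (Sψ : Finset (ℕ × ℕ)) (ψ : ℕ × ℕ → ℝ) {κ₀ : ℝ} (hκ₀ : 0 ≤ κ₀) (Q : Set (ℝ × ℝ)) (E_T : ℝ)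
    (hK : ∀ p ∈ Q, ∀ u v : ℝ, 0 ≤ u → 0 ≤ v → E_T ≤ u + v →
      (1 / 2 : ℝ) ^ (p.1 + p.2) * |evenKernel (w 2) S ((p.1 + p.2) / 2) (-1) u v| ≤
          evenKernel ψ Sψ 0 0 u v ∧
        κ₀ / 2 * ((1 / 2 : ℝ) ^ (p.2 - p.1) * |evenKernel (w 2) S ((p.1 + p.2) / 2) (-1) u v|) +
            κ₀⁻¹ / 2 * ((1 / 2 : ℝ) ^ (-(2 * p.2)) * evenKernel ψ Sψ (p.1 - p.2) 0 u v) ≤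
          evenKernel (w 3) S p.1 (-1) u v - evenKernel (w 4) S p.1 1 u v) :
    ∀ p ∈ Q, ∀ (E : ℝ) (j : ℕ), E_T ≤ E → (j : ℝ) ≤ E →
      OddConeAt (taylorCrossing (1 / 2) (1 / 2) S w)
        (∑ ab ∈ Sψ, ψ ab • taylorCoeffAt (1 / 2) (1 / 2) ab) κ₀ p.1 p.2 E j :=
  fun p hp E j hE hj => oddCone_half_of_kernelCone S w Sψ ψ hκ₀ p.1 p.2 E_T (hK p hp) E j hE hj

/-- **Hybrid introduction of the `odd_cone` field**: small `j ≤ J₁` by the exact q-form (M̂)/(R̂) of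
`oddConeAt_half_of_qCone` (for each such integer `j` a condition in the ONE real variable `E ≥ max(E_T, j)`),
large `j > J₁` by the pointwise kernel inequalities (KM)/(KR) on the FAR region `{u, v ≥ 0, u + v ≥ E₁}` with
`E₁ ≤ J₁ + 1` and `E₁ ≤ E_T`-or-larger handled by `max` (the antidiagonal points of a monomial with `j > J₁`
have `u + v = E ≥ j ≥ J₁ + 1`). `κ₀ ≥ 0`. [cite: KosPolandSimmonsduffin2014, §3.3 eq. (3.16)] -/
theorem oddConeField_half_of_hybrid (S : Finset (ℕ × ℕ)) (w : Fin 5 → ℕ × ℕ → ℝ)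
    (Sψ : Finset (ℕ × ℕ)) (ψ : ℕ × ℕ → ℝ) {κ₀ : ℝ} (hκ₀ : 0 ≤ κ₀) (Q : Set (ℝ × ℝ)) (E_T : ℝ)
    (J₁ : ℕ) (E₁ : ℝ) (hE₁ : E₁ ≤ (J₁ : ℝ) + 1)
    (hsmall : ∀ p ∈ Q, ∀ (j : ℕ), j ≤ J₁ → ∀ E : ℝ, E_T ≤ E → (j : ℝ) ≤ E →
      (1 / 2 : ℝ) ^ (p.1 + p.2) * |qSum (w 2) S ((p.1 + p.2) / 2) (-1) E j| ≤ qSum ψ Sψ 0 0 E j ∧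
        κ₀ / 2 * ((1 / 2 : ℝ) ^ (p.2 - p.1) * |qSum (w 2) S ((p.1 + p.2) / 2) (-1) E j|) +
            κ₀⁻¹ / 2 * ((1 / 2 : ℝ) ^ (-(2 * p.2)) * qSum ψ Sψ (p.1 - p.2) 0 E j) ≤
          qSum (w 3) S p.1 (-1) E j - qSum (w 4) S p.1 1 E j)
    (hfar : ∀ p ∈ Q, ∀ u v : ℝ, 0 ≤ u → 0 ≤ v → E₁ ≤ u + v → E_T ≤ u + v →
      (1 / 2 : ℝ) ^ (p.1 + p.2) * |evenKernel (w 2) S ((p.1 + p.2) / 2) (-1) u v| ≤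
          evenKernel ψ Sψ 0 0 u v ∧
        κ₀ / 2 * ((1 / 2 : ℝ) ^ (p.2 - p.1) * |evenKernel (w 2) S ((p.1 + p.2) / 2) (-1) u v|) +
            κ₀⁻¹ / 2 * ((1 / 2 : ℝ) ^ (-(2 * p.2)) * evenKernel ψ Sψ (p.1 - p.2) 0 u v) ≤
          evenKernel (w 3) S p.1 (-1) u v - evenKernel (w 4) S p.1 1 u v) :
    ∀ p ∈ Q, ∀ (E : ℝ) (j : ℕ), E_T ≤ E → (j : ℝ) ≤ E →
      OddConeAt (taylorCrossing (1 / 2) (1 / 2) S w)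
        (∑ ab ∈ Sψ, ψ ab • taylorCoeffAt (1 / 2) (1 / 2) ab) κ₀ p.1 p.2 E j := by
  intro p hp E j hE hj
  by_cases hjJ : j ≤ J₁
  · obtain ⟨hM, hR⟩ := hsmall p hp j hjJ E hE hj
    exact oddConeAt_half_of_qCone S w Sψ ψ κ₀ p.1 p.2 E j hj hM hR
  · -- far region: all antidiagonal points of `𝒫_{E,j}` have `u + v = E ≥ j ≥ J₁ + 1 ≥ E₁`
    have hj' : (J₁ : ℝ) + 1 ≤ (j : ℝ) := by
      have : J₁ + 1 ≤ j := by omega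
      exact_mod_cast this
    have hEfar : max E_T E₁ ≤ E := max_le hE (by linarith)
    refine oddCone_half_of_kernelCone S w Sψ ψ hκ₀ p.1 p.2 (max E_T E₁)
      (fun u v hu hv huv => hfar p hp u v hu hv ((le_max_right _ _).trans huv)
        ((le_max_left _ _).trans huv)) E j hEfar hj

end Summit.CriticalPhenomena.Ising3D
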